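import Mathlib.LinearAlgebra.Dimension.Finrank
import Mathlib.LinearAlgebra.FiniteDimensional.Defs
import Mathlib.Order.SupIndep
import Mathlib.Combinatorics.Enumerative.Composition
import Literature.NumberTheory.Transcendental.MultipleZeta
import Literature.NumberTheory.Transcendental.PeriodsWave0
import HarnessLib
import HarnessLib.Audit

-- provenance: harness21/H21/H21/Statements/Periods/MultipleZetaValues.lean @ 8dffb85 (interim HEAD d8f2665); M5 mechanical rewrite
/-!
# Periods family — multiple zeta values: Zagier's dimension conjecture and known bounds

Family `periods` (Kontsevich–Zagier periods), trunk `TranscendEllArithS`, concept C3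
(`multiple_zeta_values`). This file states

* **periods.S23** Zagier's dimension conjecture: `dim_ℚ 𝒵_n = d_n` with
  `d_n = d_{n-2} + d_{n-3}`, and the weight spaces `𝒵_n ⊆ ℝ` form a direct sum
  (`ZagierDimensionConjecture`, `MZVWeightGradingConjecture`, `ZagierConjecture`) — all three are
  registered **OPEN CONJECTURES** (`[status: open]`, see "Status of periods.S23" below), not
  results in print awaiting a discharge;
* **periods.S24** the known upper bound `dim_ℚ 𝒵_n ≤ d_n` (Goncharov 2001, Theorem 1.2;
  Terasoma 2002, Theorem 1.2; Deligne–Goncharov 2005, Cor. 5.25(i))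
  (`finrank_mzvSpace_le_zagierDim`) and Brown's theorem (2012, Theorem 1.1 ⟹ Conjecture 2) that
  the Hoffman elements span `𝒵_n` (`hoffmanSpan_eq_mzvSpace`) — both THEOREMS IN PRINT kept as
  named facts of size XL (their printed proofs need mixed Tate motives over `ℤ`; see "Status of
  periods.S24" below);

together with the untagged bridge `multipleZeta_singleton_eq_zetaValue` linking the depth-one
MZV `ζ(k)` of the Prelude with `Literature.Periods.zetaValue k` of `H21/Statements/Periods/Wave0.lean`,
the finite-dimensionality of `𝒵_n` (proved: the generators are indexed by compositions of `n`),
and the combinatorial sanity statement `zagierDim_eq_card_hoffman` (`d_n` counts the Hoffman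
indices of weight `n`).

All the underlying objects (`Literature.NumberTheory.Transcendental.multipleZeta`, `Literature.NumberTheory.Transcendental.mzvSpace`, `Literature.NumberTheory.Transcendental.hoffmanSpan`,
`Literature.NumberTheory.Transcendental.zagierDim`, `Literature.NumberTheory.Transcendental.MZV.IsHoffman`, `Literature.NumberTheory.Transcendental.MZV.weight`) come from
`H21/Prelude/TranscendEllArithS/MultipleZeta.lean`; `zetaValue` comes from the Wave0 statements
file. Mathlib has `riemannZeta`, `Module.finrank`, `iSupIndep` and `Composition` (used here) but no
multiple zeta values (checked by grep).

Design choices.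
* Open conjectures are `def …Conjecture : Prop` whose docstring starts `OPEN CONJECTURE —` and
  carries `[status: open]` (CONVENTIONS §4); results in print not yet proved here are named facts
  `def X : Prop` (D-0014), discharged by `theorem X_holds : X` in the sibling `…Proofs` files.
* `Module.finrank` returns the junk value `0` on infinite-dimensional spaces; this is harmless
  since `finiteDimensional_mzvSpace` shows `𝒵_n` is finite-dimensional.
* "The `𝒵_n` form a direct sum inside `ℝ`" is `iSupIndep mzvSpace` in the complete lattice
  `Submodule ℚ ℝ`.

## Status of periods.S23 (re-verified 2026-08-15 against the sources below)

All three `…Conjecture` declarations are OPEN PROBLEMS, registered here as conjectures and not as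
literature debt (no `…_holds` discharge is expected; users keep them as explicit hypotheses):

* `ZagierDimensionConjecture` — posed by Zagier (ECM 1992, printed 1994, §9 p. 509) from
  numerical evidence up to weight `12`; printed as a conjecture in Goncharov (ECM 2000, §1.1,
  after Conjecture 1.1: "if `d_k := dim 𝒵_k` then one should have `d_k = d_{k-2} + d_{k-3}`"),
  Waldschmidt (2004, §3, *Conjecture (Zagier)*) and Chmutov–Duzhin–Mostovoy (2012, §10.2.6,
  Conjecture 10.20). Known: `≤` (Goncharov; Terasoma 2002; Deligne–Goncharov 2005; Brown 2012 —
  `finrank_mzvSpace_le_zagierDim`, `hoffmanSpan_eq_mzvSpace`) and equality for `n ≤ 4`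
  (`finrank_mzvSpace_eq_zagierDim_of_le_four` in `MultipleZetaValuesWeightFourProofs.lean`);
  for `n = 5` (`d₅ = 2`) equality says `ζ(5)` and `ζ(2)ζ(3)` are `ℚ`-linearly independent,
  which is open ("we believe that `ζ(5) ∉ ℚ` but nobody can prove it", Goncharov, loc. cit.).
* `MZVWeightGradingConjecture` — Goncharov's Conjecture 1.1 a) (ECM 2000): "the weight provides
  a grading on the algebra `𝒵`", i.e. no `ℚ`-linear relations among MZVs of different weights;
  Waldschmidt (2004, §3, *Conjecture (Goncharov)*: "as a `ℚ`-algebra, `𝔷` is the direct sum of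
  the `𝔷_p`, `p ≥ 0`"); Chmutov–Duzhin–Mostovoy (2012, §10.2.6: "conjecturally the sum of all
  `𝒵_i`'s is direct"). Open: already its instance `𝒵₀ ⊓ 𝒵₅ = 0` is the irrationality of
  `ζ(5)` (`MZVWeightGradingConjecture.irrational_multipleZeta_five` in
  `MultipleZetaValuesProofs.lean` derives it from the conjecture).
* `ZagierConjecture` — the conjunction (Hilbert–Poincaré series `1 / (1 - t² - t³)` of the
  weight-graded algebra; Chmutov–Duzhin–Mostovoy 2012, Conjecture 10.20), open with both halves.

## Status of periods.S24 (re-verified 2026-08-15 against the sources below)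

Both S24 declarations are THEOREMS IN PRINT, faithfully stated, and literature debt of size XL
(a whole theory is missing; D-0026 review of `finrank_mzvSpace_le_zagierDim`, 2026-08-15): they
stay named facts, users keep `(h : …)` hypotheses, and no `…_holds` discharge is reachable by
elementary means — prove seats should not be pointed at them until a library of mixed Tate
motives over `ℤ` exists.

* `finrank_mzvSpace_le_zagierDim` — Terasoma 2002, Theorem 1.2 (Main Theorem): `dim L_n ≤ d_n`,
  where `L_n = ∑ ζ(k₁, …, k_l) ℚ ⊆ ℝ` over `k₁ + ⋯ + k_l = n`, `kᵢ ≥ 1`, `k_l ≥ 2`, with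
  `ζ(k₁, …, k_l) = ∑_{m₁ < ⋯ < m_l} m₁^{-k₁} ⋯ m_l^{-k_l}` — the mirror image of Zagier's convention
  used by `multipleZeta`, so `L_n = 𝒵_n = mzvSpace n` — and `d₀ = 1, d₁ = 0, d₂ = 1,
  d_{i+3} = d_{i+1} + d_i` (`= zagierDim`); announced as Goncharov, ECM 2000 (2001), Theorem 1.2
  (`dim 𝒵_k ≤ dim (ℚ[π²] ⊗ U𝓕(3,5,…)^∨)_k`); Deligne–Goncharov 2005, Cor. 5.25(i) (for `N = 1`
  the generating series of the dimensions `D_n` of the `ℚ`-span of the degree-`n` coefficients of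
  `dch(σ)` is majorised term by term by `1/(1 - t² - t³)`) with Rem. 5.26 ("pour `N = 1`, nous
  retrouvons ainsi le résultat de Terasoma"). So the statement is exactly as printed (`n = 0`:
  `𝒵₀ = ℚ`, `d₀ = 1`; `n = 1`: `𝒵₁ = ⊥`, `d₁ = 0`). Every printed proof is motivic: Terasoma uses
  Levine's `DTM(ℚ)` with `Hom_{DTM(ℚ)}(ℚ, ℚ(i)[1]) = K_{2i-1}(ℚ) ⊗ ℚ` and the periods of the
  relative cohomology `Hⁿ(Y⁰, j_! ℚ)` of an iterated blow-up (§1 outline, §§2–5); Goncharov and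
  Deligne–Goncharov use `MT(ℤ)`, the motivic fundamental groupoid of `ℙ¹ ∖ {0, 1, ∞}` with
  tangential base points and the freeness of the enveloping algebra of `Lie U_ω^gr` on one
  generator in each odd degree `≥ 3` (proof of Cor. 5.25); Brown adds motivic MZVs and the
  coaction. None of this exists in Mathlib or in this tree, and we know of no proof in print that
  avoids mixed Tate motives. Proved here (sorry-free, sibling files): the bound for
  all `n ≤ 9` unconditionally (`finrank_mzvSpace_le_zagierDim_of_le_nine`,
  `MultipleZetaValuesHoffmanProofs.lean`, weight by weight from finite double-shuffle and duality
  certificates); the counting half of the printed proofs — `d_n = #{w ∈ {2,3}^× : |w| = n}`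
  (`zagierDim_eq_card_hoffman_holds`), Terasoma's Lemma 5.2 and Brown's Lemma 2.5 — and the
  reduction to Brown's theorem `finrank_mzvSpace_le_zagierDim_of_hoffmanSpan_eq :
  hoffmanSpan_eq_mzvSpace → finrank_mzvSpace_le_zagierDim`
  (`MultipleZetaValuesDimBoundProofs.lean`). Hence `finrank_mzvSpace_le_zagierDim_holds` is one
  line once `hoffmanSpan_eq_mzvSpace_holds` exists, and otherwise exactly as far away as a
  formalisation of `MT(ℤ)`.
* `hoffmanSpan_eq_mzvSpace` — Brown 2012, §1: Theorem 1.1 (the motivic Hoffman elements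
  `ζᵐ(n₁, …, n_r)`, `nᵢ ∈ {2, 3}`, are a basis of the motivic MZVs) and "Conjecture 2 follows from
  theorem 1.1 by applying the period map" (Conjecture 2 = Hoffman spanning; §7.2, Cor. 7.5).
  Stronger than the bound above and proved with the same motivic machinery plus the coaction, the
  derivations `D_{2r+1}` and Zagier's evaluation of `ζ(2, …, 2, 3, 2, …, 2)`; architecture and
  status in `MultipleZetaValuesHoffmanProofs.lean`; proved here for `n ≤ 9`
  (`hoffmanSpan_eq_mzvSpace_of_le_nine`).

## References

* D. Zagier, *Values of zeta functions and their applications*, First European Congress of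
  Mathematics (Paris, 1992), Vol. II, Progr. Math. 120, Birkhäuser (1994), 497–512, §1 and §9
  (p. 509: multiple zeta values, the dimension conjecture). [ZagierECM1994] (= interim key
  [Zagier1994])
* A. B. Goncharov, *Multiple ζ-values, Galois groups, and geometry of modular varieties*,
  European Congress of Mathematics (Barcelona, 2000), Vol. I, Progr. Math. 201, Birkhäuser
  (2001), 361–392, §1.1 Conjecture 1.1 (a: weight grading; b: structure, whence
  `d_k = d_{k-2} + d_{k-3}`), Theorem 1.2 (upper bound) (arXiv math/0005069). [GoncharovECM2001]
* M. Waldschmidt, *Open Diophantine Problems*, Moscow Math. J. 4 (2004), 245–305, §3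
  (multiple zeta values): Conjecture (Goncharov), Conjecture (Zagier) (arXiv math/0312440,
  p. 7). [Waldschmidt2004]
* S. Chmutov, S. Duzhin, J. Mostovoy, *Introduction to Vassiliev Knot Invariants*, Cambridge
  Univ. Press (2012), §10.2.6, Proposition 10.19 and Conjecture 10.20 (Zagier 1994).
  [ChmutovDuzhinMostovoy2012]
* M. Hoffman, *The algebra of multiple harmonic series*, J. Algebra 194 (1997), 477–495.
  [Hoffman1997]
* T. Terasoma, *Mixed Tate motives and multiple zeta values*, Invent. Math. 149 (2002), 339–369
  (arXiv:math/0104231), §1: Conjecture 1.1 (Zagier), Theorem 1.2 (Main Theorem) `dim L_n ≤ d_n`;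
  proof §§2–5. [Terasoma2002]
* P. Deligne, A. Goncharov, *Groupes fondamentaux motiviques de Tate mixte*,
  Ann. Sci. ENS 38 (2005), 1–56, Thm. 5.24, Cor. 5.25(i), Rem. 5.26, 5.27. [DeligneGoncharov2005]
* F. Brown, *Mixed Tate motives over ℤ*, Ann. of Math. 175 (2012), 949–976 (arXiv:1102.1312), §1:
  Conjecture 2, Theorem 1.1, Corollary 1.2; §7.2 Corollary 7.5. [Brown2012]
-/

noncomputable section

open scoped Classical

namespace Literature.NumberTheory.Transcendental

/-! ### Bridge to `zetaValue` -/

/-- Depth one: the multiple zeta value `ζ(k)` of the Prelude equals the real zeta value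
`Literature.Periods.zetaValue k = ∑' n : ℕ, 1 / n ^ k` of the Wave0 file, for `k ≥ 2`. The Prelude series
runs over `n ≥ 1`; `zetaValue` runs over `n ≥ 0` with the `n = 0` summand equal to Mathlib's junk
value `1 / 0 ^ k = 0` (Zagier 1994, §1; cf. Mathlib's `zeta_nat_eq_tsum_of_gt_one`). [cite: Zagier1994, §1] -/
def multipleZeta_singleton_eq_zetaValue : Prop :=
  ∀ (k : ℕ) (hk : 2 ≤ k),
    multipleZeta [k] = Literature.NumberTheory.Transcendental.zetaValue k

/-! ### Finite-dimensionality of the weight spaces -/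

/-- The generating set of `𝒵_n` (MZVs of admissible indices of weight `n`) is finite: admissible
indices of weight `n` are among the compositions of `n` (Zagier 1994, §1). [cite: Zagier1994, §1] -/
theorem finite_setOf_multipleZeta_weight (n : ℕ) :
    {x : ℝ | ∃ s, MZV.IsAdmissible s ∧ MZV.weight s = n ∧ x = multipleZeta s}.Finite := by
  refine (Set.finite_range fun c : Composition n => multipleZeta c.blocks).subset ?_
  rintro x ⟨s, hs, hw, rfl⟩
  exact ⟨⟨s, fun hi => hs.1 _ hi, hw⟩, rfl⟩

/-- The weight space `𝒵_n` is a finite-dimensional `ℚ`-vector space, being spanned by the finitely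
many MZVs of admissible indices of weight `n` (Zagier 1994, §1). [cite: Zagier1994, §1] -/
instance finiteDimensional_mzvSpace (n : ℕ) : FiniteDimensional ℚ (mzvSpace n) :=
  FiniteDimensional.span_of_finite ℚ (finite_setOf_multipleZeta_weight n)

/-! ### periods.S23: Zagier's conjecture -/

/-- OPEN CONJECTURE — Zagier's dimension conjecture, posed in Zagier, *Values of zeta functions
and their applications* (ECM Paris 1992), Progr. Math. 120 (1994), §9 p. 509, from numerical
evidence up to weight `12`; printed as a conjecture in Goncharov (ECM 2000, §1.1: "if
`d_k := dim 𝒵_k` then one should have `d_k = d_{k-2} + d_{k-3}`"), Waldschmidt (2004, §3,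
*Conjecture (Zagier)*: for `p ≥ 3`, `d_p = d_{p-2} + d_{p-3}` with `d₀ = 1, d₁ = 0, d₂ = 1`) and
Chmutov–Duzhin–Mostovoy (2012, §10.2.6, Conjecture 10.20: `∑_w dim_ℚ 𝒵_w · t^w = 1/(1 - t² - t³)`).
[status: open]

**periods.S23** `dim_ℚ 𝒵_n = d_n` for every `n`, where `𝒵_n ⊆ ℝ` is the `ℚ`-span of the
multiple zeta values of weight `n` and `d₀ = 1, d₁ = 0, d₂ = 1, d_n = d_{n-2} + d_{n-3}`
(`zagierDim`). Known: the upper bound `≤` (Goncharov; Terasoma 2002; Deligne–Goncharov 2005;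
Brown 2012 — the named facts `finrank_mzvSpace_le_zagierDim`, `hoffmanSpan_eq_mzvSpace`) and
equality for `n ≤ 4` (`finrank_mzvSpace_eq_zagierDim_of_le_four`); from `n = 5` (`d₅ = 2`) on it
is open (it asserts the `ℚ`-linear independence of `ζ(5)` and `ζ(2)ζ(3)`). Not literature debt:
no discharge `ZagierDimensionConjecture_holds` is expected; users take it as an explicit
hypothesis. [cite: ZagierECM1994, §9 p. 509] -/
@[conjecture] def ZagierDimensionConjecture : Prop :=
  ∀ n : ℕ, Module.finrank ℚ (mzvSpace n) = zagierDim n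

/-- OPEN CONJECTURE — the weight-grading (direct-sum) conjecture for multiple zeta values, posed
in print as Goncharov's Conjecture 1.1 a), *Multiple ζ-values, Galois groups, and geometry of
modular varieties* (ECM Barcelona 2000), Progr. Math. 201 (2001), §1.1: "the weight provides a
grading on the algebra `𝒵`" — "relations between `ζ`'s of different weight, like
`ζ(5) = λ · ζ(7)` where `λ ∈ ℚ`, are impossible"; restated in Waldschmidt (2004, §3,
*Conjecture (Goncharov)*: "as a `ℚ`-algebra, `𝔷` is the direct sum of the `𝔷_p` for `p ≥ 0`")
and Chmutov–Duzhin–Mostovoy (2012, §10.2.6: "conjecturally the sum of all `𝒵_i`'s is direct");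
implicit in Zagier (1994, §9). [status: open]

**periods.S23** The weight spaces `𝒵_n ⊆ ℝ` form a direct sum, i.e. the family `n ↦ 𝒵_n` of
`ℚ`-subspaces of `ℝ` is independent (`iSupIndep` in the complete lattice `Submodule ℚ ℝ`): there
are no `ℚ`-linear relations among MZVs of different weights. Open: since `𝒵₀ = ℚ`, already the
instance `𝒵₀ ⊓ 𝒵_{2k+1} = ⊥` is the irrationality of `ζ(2k+1)` (known only for `k = 1`, Apéry;
see `MZVWeightGradingConjecture.irrational_multipleZeta_five` in `MultipleZetaValuesProofs.lean`
for what the conjecture forces). Not literature debt: no discharge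
`MZVWeightGradingConjecture_holds` is expected; users take it as an explicit hypothesis.
[cite: GoncharovECM2001, §1.1 Conjecture 1.1 a)] -/
@[conjecture] def MZVWeightGradingConjecture : Prop :=
  iSupIndep mzvSpace

/-- OPEN CONJECTURE — Zagier's conjecture in combined form (dimension conjecture ∧ weight grading),
posed in Zagier, ECM Paris 1992, Progr. Math. 120 (1994), §9 p. 509, and as Goncharov's
Conjecture 1.1 a)–b) (ECM 2000, Progr. Math. 201, §1.1); printed as Conjecture 10.20 of
Chmutov–Duzhin–Mostovoy (2012, §10.2.6): the Poincaré series of the weight-graded algebra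
`𝒵_• = ⨁_w 𝒵_w` is `1 / (1 - t² - t³)`; Waldschmidt 2004, §3 (Conjecture (Zagier) and
Conjecture (Goncharov)). [status: open]

**periods.S23** `dim_ℚ 𝒵_n = d_n` for all `n` (`ZagierDimensionConjecture`) and the `𝒵_n` form
a direct sum inside `ℝ` (`MZVWeightGradingConjecture`), so that the `ℚ`-algebra of MZVs is graded
by weight with Hilbert series `1 / (1 - t² - t³)`. Open, both conjuncts being open; not
literature debt (no discharge `ZagierConjecture_holds` is expected). [cite: ZagierECM1994, §9 p. 509] -/
@[conjecture] def ZagierConjecture : Prop :=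
  ZagierDimensionConjecture ∧ MZVWeightGradingConjecture

/-! ### periods.S24: known results -/

/-- **periods.S24** (Terasoma 2002, Theorem 1.2 (Main Theorem) `dim L_n ≤ d_n`; announced in
Goncharov, ECM 2000, Theorem 1.2; Deligne–Goncharov 2005, Cor. 5.25(i) with Rem. 5.26). The upper
bound in Zagier's conjecture holds: `dim_ℚ 𝒵_n ≤ d_n` for every `n`, where `𝒵_n = mzvSpace n` is
the `ℚ`-span in `ℝ` of the multiple zeta values of admissible indices of weight `n` (Terasoma's
`L_n`, written with the mirror-image index convention `∑_{m₁ < ⋯ < m_l}`, `k_l ≥ 2`) and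
`d₀ = 1, d₁ = 0, d₂ = 1, d_{i+3} = d_{i+1} + d_i` (`zagierDim`). A theorem in print whose every
printed proof goes through mixed Tate motives over `ℤ` (absent from Mathlib and this tree): kept
as a named fact of size XL — see "Status of periods.S24" in the module docstring. Proved in this
tree for `n ≤ 9` (`finrank_mzvSpace_le_zagierDim_of_le_nine`) and, for all `n`, from Brown's
theorem (`finrank_mzvSpace_le_zagierDim_of_hoffmanSpan_eq : hoffmanSpan_eq_mzvSpace → …`), which
is the intended discharge path. [cite: Terasoma2002, Theorem 1.2] -/
def finrank_mzvSpace_le_zagierDim : Prop :=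
  ∀ (n : ℕ),
    Module.finrank ℚ (mzvSpace n) ≤ zagierDim n

/-- **periods.S24** (Brown 2012, Theorem 1.1; conjectured by Hoffman 1997). The Hoffman elements
`ζ(s₁, …, s_k)` with all `sᵢ ∈ {2, 3}` and `s₁ + ⋯ + s_k = n` span `𝒵_n` over `ℚ`. [cite: Brown2012, Theorem 1.1] -/
def hoffmanSpan_eq_mzvSpace : Prop :=
  ∀ (n : ℕ),
    hoffmanSpan n = mzvSpace n

/-- Sanity check on Zagier's dimensions: `d_n` is the number of Hoffman indices (words in `{2, 3}`)
of weight `n`, since both satisfy `d_n = d_{n-2} + d_{n-3}` with `d₀ = 1, d₁ = 0, d₂ = 1`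
(Hoffman 1997; Brown 2012, §1). Together with `hoffmanSpan_eq_mzvSpace` this recovers
`finrank_mzvSpace_le_zagierDim`. [cite: Hoffman1997] -/
def zagierDim_eq_card_hoffman : Prop :=
  ∀ (n : ℕ),
    zagierDim n = Nat.card {s : List ℕ // MZV.IsHoffman s ∧ MZV.weight s = n}

end Literature.NumberTheory.Transcendental
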